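import Summits.ResolutionOfSingularities.ResolutionOfSingularities.Theorems.MaxContactCutTauChainCut
import Summits.ResolutionOfSingularities.ResolutionOfSingularities.Theorems.RestrictCutPort2
import HarnessLib

/-!
# MaxContactCutPortDischarge2 — decomp-res RIDER «PortDischarge» (lens-4 g34, critic row 194a (MAP (M-27723) +1)),
tree file 4/4 of the rider

Content VERBATIM from the decomp-res lens-4 g34 RIDER `HOME/decomp-res-lens-4/g34/FactorContactPortDischarge.lean`
(pin 9c49c6fa); HOME = run/shared/lean/pub/decomp-res; critic row 194a (MAP (M-27723) +1); landing orders INBOX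
:1147/:1163 — provenance, critic text and the rider header in full in the first file, `RestrictCutPort`.  Namespace
`…Theorems.HugValuationCut`.

## This file

§114b (g34 rider · NEW) ITEM 27721 BY NAME in the Theses cone (`section PortThesesCone`): `fcNoTameDriftingTowers_holds : MaxContactCut.FCNoTameDriftingTowers` — the g17 DECIDED-MOD-PORT cell (L,P,drift,tame) of route MaxContactCut (item stmt-ResolutionOfSingularities-27721) is DECIDED UNCONDITIONALLY (`:= noTameDriftingTowers_holds` of `RestrictCutPort2`, its port being discharged).  Proposed `--kind proof --workitem stmt-ResolutionOfSingularities-27721` (proof of item; one proof-of-item file per item, as the critic rider allows).  Imports `RestrictCutPort2` + `MaxContactCutTauChainCut`; 0 sorry.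

[WRITER NOTE (decomp-res writer g12): file split only (tree files ≤ 400 lines); namespace, sections, section
variables / universes / opens and every declaration exactly as in the rider (its §105 carry and file-level
dupNamespace-linter line dropped; the `open …Theses` line lives only in the Theses-cone files `MaxContactCutPortDischarge*`).]

(Sources: Hironaka1964 Ch. III; Giraud1975; Kollar2007 3.58–3.60; CossartJannsenSaito2020 Thm. 6.40, Ch. 8;
Hauser2010Kangaroo; HauserPerlega2019 §2; CossartPiltant2008 §2; deJong1996; Hironaka2005; EGAIV2 §5 (dimension),
EGAIV4 §16, §21; Matsumura1987 §14–§15 (dimension of quotients), §20, §28; Liu2002 §8.2 (blow-ups: integrality,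
birationality, dimension); StacksProject 02ND / 0804 / 0BIQ / 031I / 0AFT.)
-/

noncomputable section

open CategoryTheory AlgebraicGeometry IsLocalRing TopologicalSpace
open Literature.AlgebraicGeometry.Resolution
open Literature.AlgebraicGeometry.Resolution.Hironaka2005 (le_idealOrder_of_mul_le le_idealOrder_of_mul_le')
open Summit.ResolutionOfSingularities.ResolutionOfSingularities.Theses
open Summit.ResolutionOfSingularities.ResolutionOfSingularities.Theorems
open WeakOrderReduction ForcedTowerClasses DivergentTowerClasses MonomialTowerClasses
open HugDimensionClasses HugDimensionKernels SurfaceShadowClasses SurfaceShadowKernels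
open NearPointCut (SingularClass)
open AbsoluteContactClasses (IsAbsContactAt)
open Scheme.IdealSheafData (vanishingIdeal)
open scoped BigOperators nonZeroDivisors

namespace Summit.ResolutionOfSingularities.ResolutionOfSingularities.Theorems.HugValuationCut

section PortThesesCone

/-- **ITEM 27721 (`MaxContactCut.FCNoTameDriftingTowers`, the DECIDED-MOD-PORT cell (L,P,drift,tame) of g17) IS NOW DECIDED
UNCONDITIONALLY, BY NAME** (its port is discharged). [folklore] -/
theorem fcNoTameDriftingTowers_holds : MaxContactCut.FCNoTameDriftingTowers := noTameDriftingTowers_holds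

end PortThesesCone

end Summit.ResolutionOfSingularities.ResolutionOfSingularities.Theorems.HugValuationCut
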